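import Summits.NavierStokesRegularity.NavierStokesRegularity.Theses.QuantisedSymmetry
import Summits.NavierStokesRegularity.NavierStokesRegularity.Theorems.QuantisedSymmetryPolyhedralTruncationBridge
import Summits.NavierStokesRegularity.NavierStokesRegularity.Theorems.FilamentSkeletonRssRdssProfileTruncation
import Literature.Analysis.FluidPDE.SelfSimilar
import Literature.Analysis.FluidPDE.SelfSimilarLiouville
import HarnessLib

/-!
# Strategist sketch S14-g10 — crux `PolyhedralDssProfileExists` (stmt-NavierStokesRegularity-1404)

Typed companion of `STRATEGY-CENSUS-s14.md` (independent strategy census, family `s`,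
generation 10, route `route-NavierStokesRegularity-QuantisedSymmetry`). Every declaration in this
file elaborates with **no `sorry`**; open statements are `def … : Prop` only and are NOT route
items (nothing here is registered; the census explains why none of them is a line short of the
summit).

* §0 `crux_decides_negatively` — the crux ALONE proves `¬ NavierStokesRegularity` from tree
  theorems (`closes`, `quantisedSymmetry_polyhedralTruncationBridge_proof`, `ClayUniqueness_holds`);
  `replacement_is_summit_strength` — any statement `W` that can stand in for the crux in the
  deciding theorem already decides the summit negatively on its own (the structural reason the
  "strictly weaker intermediate" heading is empty for a one-open-crux refutation route).
* §1 the ladder `C → W₁ → W₂ → ¬S` of weaker intermediates (`TypeIDssProfileExists` = a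
  counterexample to Tsai's Type-I DSS Liouville problem with the symmetry group dropped;
  `FiniteTimeBlowupExists` = a Leray–Hopf classical solution of finite maximal lifespan from a
  rapidly decaying datum), every rung a tree theorem; `W₁ ↔ ¬ ∀ λ, TypeIDSSLiouville λ`.
* §2 typed decompositions. D1 `StripFixedPoint` (one period of the similarity flow closes up on a
  finite time strip) with gluing piece and proved assembly — and the COLLAPSE
  `crux_imp_stripFixedPoint` (the ∃-piece is the crux again). D3 the final-trace split
  `NonzeroTraceProfileExists` / `TrivialTraceLiouville` with `nonzeroTrace_imp_crux` and
  `crux_iff_nonzeroTrace` (a restatement, not a redirect). D2 (certificate + Newton–Kantorovich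
  scheme) is recorded as the abstract scheme `BanachBallFixedPointScheme` only: its problem-side
  piece needs a functional model of the DSS profile problem and a numerical candidate, neither of
  which exists (census §4).
* §3 the strengthening S⁺₁ `SteadyPolyhedralProfileExists` (continuous self-similarity) with
  `steady_imp_crux`; it is EMPTY by Tsai 1998 / NRŠ 1996 (`Literature.Analysis.FluidPDE.tsai_selfsimilar`,
  proved in tree as `tsai_selfsimilar_holds`), census §3.
-/

set_option linter.dupNamespace false
set_option autoImplicit false

namespace Summit.NavierStokesRegularity.NavierStokesRegularity.Cruxes.PolyhedralDssProfileExists.S14g10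

open MeasureTheory Set Filter Topology
open Literature.Analysis.FluidPDE
open Summit.NavierStokesRegularity.NavierStokesRegularity.Theses.QuantisedSymmetry
open Summit.NavierStokesRegularity.NavierStokesRegularity.Theorems

/-- `ℝ³` as in the route file. -/
abbrev E3 : Type := EuclideanSpace ℝ (Fin 3)

/-! ## §0 The crux alone decides the summit (negatively) -/

/-- **Load-bearing fact of the census.** With `PolyhedralTruncationBridge` (stmt-11331) and
`ClayUniqueness` (stmt-0153) PROVED in the tree, the open crux alone refutes the Clay statement:
`PolyhedralDssProfileExists → ¬ NavierStokesRegularity` is a theorem (composition of `closes`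
with the two proofs). Hence every statement that could replace the crux and still close the
route is at least as strong as `¬ NavierStokesRegularity`. -/
theorem crux_decides_negatively :
    PolyhedralDssProfileExists → ¬ _root_.NavierStokesRegularity := fun hX =>
  closes hX quantisedSymmetry_polyhedralTruncationBridge_proof ClayUniqueness_holds

/-- Structural corollary (heading "weaker intermediate"): any `W` that can stand in for the crux
in the deciding theorem — i.e. `W → PolyhedralTruncationBridge → ClayUniqueness → ¬NSR` is
provable — already gives `¬NSR` by itself. A replacement short of the summit's negation does not
exist for this route shape; only a split into ≥ 2 open pieces could be "short of the summit". -/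
theorem replacement_is_summit_strength {W : Prop}
    (hW : W → PolyhedralTruncationBridge → ClayUniqueness → ¬ _root_.NavierStokesRegularity) :
    W → ¬ _root_.NavierStokesRegularity := fun w =>
  hW w quantisedSymmetry_polyhedralTruncationBridge_proof ClayUniqueness_holds

/-! ## §1 The ladder of weaker intermediates `C → W₁ → W₂ → ¬S` -/

/-- `W₁`: the crux with the symmetry group dropped — a nontrivial ancient mild solution
(`ν = 1`, measurable slices) which is `λ`-DSS for some `λ > 1` with the Type-I bound
`‖u(t,x)‖ ≤ C₀/(‖x‖ + √(−t))`: a counterexample to Tsai's Type-I DSS Liouville problem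
(`Literature.Analysis.FluidPDE.TypeIDSSLiouville`, Bradshaw–Tsai 2017 CPDE Open Problem 5.1). -/
def TypeIDssProfileExists : Prop :=
  ∃ c : ℝ, 1 < c ∧ ∃ u : ℝ → E3 → E3, IsAncientMildSolution 1 u ∧
    (∀ t < 0, AEStronglyMeasurable (u t) volume) ∧ IsDiscretelySelfSimilar c u ∧
    (∃ C₀ : ℝ, HasTypeIDecay C₀ u) ∧ ¬ (∀ t < 0, u t =ᵐ[volume] 0)

/-- `W₂`: a finite-time blow-up — some rapidly decaying datum has a Leray–Hopf classical solution
with finite maximal lifespan (the conclusion of the truncation bridges). -/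
def FiniteTimeBlowupExists : Prop :=
  ∃ ν : ℝ, 0 < ν ∧ ∃ T : ℝ, 0 < T ∧ ∃ (v : ℝ → E3 → E3) (p : ℝ → E3 → ℝ),
    IsMaximalSmoothSolution ν 0 v p T ∧ IsLerayHopfOn T ν 0 (v 0) v ∧ HasRapidSpatialDecay (v 0)

/-- `C → W₁`: forget the group. -/
theorem crux_imp_W1 : PolyhedralDssProfileExists → TypeIDssProfileExists := by
  rintro ⟨G, -, -, -, c, hc, u, hanc, hmeas, hdss, hdec, -, hnt⟩
  exact ⟨c, hc, u, hanc, hmeas, hdss, hdec, hnt⟩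

/-- `W₁ → W₂`: the conjecture-free rotated truncation bridge of route FilamentSkeletonRss
(stmt-NavierStokesRegularity-11289, proved `filamentSkeletonRss_rdssProfileTruncation_proof`) at the
trivial rotation. -/
theorem W1_imp_W2 : TypeIDssProfileExists → FiniteTimeBlowupExists := by
  rintro ⟨c, hc, u, hanc, hmeas, hdss, hdec, hnt⟩
  exact filamentSkeletonRss_rdssProfileTruncation_proof
    ⟨c, LinearIsometryEquiv.refl ℝ E3, u, hc, hanc, hmeas, isRotatedDSS_refl_iff.mpr hdss, hdec, hnt⟩

/-- `W₂ → ¬S`: Clay (A) applied to the datum of the blowing-up solution plus `ClayUniqueness`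
(proved) — the argument of `closes`, verbatim. -/
theorem W2_decides_negatively : FiniteTimeBlowupExists → ¬ _root_.NavierStokesRegularity := by
  rintro ⟨ν, hν, T, hT, u, p, ⟨hcl, hmax⟩, hLH, hdecay⟩ hA
  have h0 : (0 : ℝ) ∈ Set.Ico 0 T := ⟨le_rfl, hT⟩
  obtain ⟨u', p', hu', hp', hns, hbe⟩ :=
    hA ν hν (u 0) (hcl.contDiff_velocity h0) (hcl.divFree 0 h0) hdecay
  have heq : ∀ t ∈ Set.Ico 0 T, u' t = u t :=
    ClayUniqueness_holds ν hν (u 0) hdecay u' u p' p T hT hu' hp' hns hbe hcl hLH rfl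
  have hcl' : IsClassicalNSSolutionOn (Set.Ici 0) ν 0 u' p' :=
    ⟨hu', hp', fun t ht x => hns.momentum t ht x, fun t ht => hns.divFree t ht⟩
  refine hmax ⟨T + 1, by linarith, u', p', ?_, heq⟩
  exact hcl'.mono (fun t ht => ht.1) (uniqueDiffOn_Ico 0 (T + 1))

/-- `W₁` is literally the failure of Tsai's Type-I DSS Liouville problem for some factor. -/
theorem W1_iff_not_forall_typeIDSSLiouville :
    TypeIDssProfileExists ↔ ¬ ∀ c : ℝ, _root_.Literature.Analysis.FluidPDE.TypeIDSSLiouville c := by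
  constructor
  · rintro ⟨c, hc, u, hanc, hmeas, hdss, hdec, hnt⟩ hL
    exact hnt (hL c hc u hanc hmeas hdss hdec)
  · intro h
    by_contra hW
    apply h
    intro c hc u hanc hmeas hdss hdec
    by_contra hnt
    exact hW ⟨c, hc, u, hanc, hmeas, hdss, hdec, hnt⟩

/-- Hence the crux refutes the (transitional Literature copy of the) Type-I DSS Liouville wall. -/
theorem crux_imp_not_typeIDSSLiouvilleConjecture :
    PolyhedralDssProfileExists → ¬ _root_.Literature.Analysis.FluidPDE.TypeIDSSLiouvilleConjecture :=
  fun h hT => (W1_iff_not_forall_typeIDSSLiouville.mp (crux_imp_W1 h)) fun c => (hT c).1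

/-- The whole ladder lands on `¬S`; each rung above `C` is therefore also summit-strength as a
replacement crux (`replacement_is_summit_strength`). -/
theorem W1_decides_negatively : TypeIDssProfileExists → ¬ _root_.NavierStokesRegularity :=
  fun h => W2_decides_negatively (W1_imp_W2 h)

/-! ## §2 Typed decompositions -/

/-- **D1 · piece T (`StripFixedPoint`).** ONE PERIOD of the similarity flow closes up: there are a
polyhedral group `G`, a factor `c > 1`, a time `t₁ < 0` and a velocity field `u` which is a mild
Navier–Stokes solution (`ν = 1`) on the closed time strip `t₁ ≤ s < t ≤ t₁/c²` (weakly
divergence-free measurable slices, Type-I bound and `G`-equivariance there), nontrivial at time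
`t₁`, and SELF-REPRODUCING after one period: `u (t₁/c²) x = c • u t₁ (c • x)` (a fixed point of
the rescaled period map). -/
def StripFixedPoint : Prop :=
  ∃ G : Subgroup (E3 ≃ₗᵢ[ℝ] E3), Finite G ∧
    (∀ g ∈ G, LinearMap.det (g.toLinearEquiv : E3 →ₗ[ℝ] E3) = 1) ∧
    (∀ V : Submodule ℝ E3, (∀ g ∈ G, ∀ v ∈ V, g v ∈ V) → V = ⊥ ∨ V = ⊤) ∧
  ∃ c : ℝ, 1 < c ∧ ∃ t₁ : ℝ, t₁ < 0 ∧ ∃ u : ℝ → E3 → E3,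
    (∀ t ∈ Icc t₁ (t₁ / c ^ 2), IsWeaklyDivFree (u t)) ∧
    (∀ s t : ℝ, t₁ ≤ s → s < t → t ≤ t₁ / c ^ 2 → IsMildNSSolutionBetween 1 0 u s t) ∧
    (∀ t ∈ Icc t₁ (t₁ / c ^ 2), AEStronglyMeasurable (u t) volume) ∧
    (∃ C₀ : ℝ, ∀ t ∈ Icc t₁ (t₁ / c ^ 2), ∀ x, ‖u t x‖ ≤ C₀ / (‖x‖ + Real.sqrt (-t))) ∧
    (∀ g ∈ G, ∀ t ∈ Icc t₁ (t₁ / c ^ 2), ∀ x, u t (g x) = g (u t x)) ∧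
    (∀ x, u (t₁ / c ^ 2) x = c • u t₁ (c • x)) ∧
    ¬ (u t₁ =ᵐ[volume] 0)

/-- **D1 · gluing piece.** A one-period self-reproducing strip solution extends, by iterated
rescaling `u ↦ nsRescale c u` forward and backward and concatenation of mild solutions, to an
ancient `G`-equivariant Type-I `c`-DSS mild solution: routine (M-sized) — which is exactly why the
split does not redirect (census §4, BC2(c): `T` is the crux modulo a routine lemma, see
`crux_imp_stripFixedPoint`). -/
def StripGluing : Prop := StripFixedPoint → PolyhedralDssProfileExists

/-- D1 assembly (modus ponens; the seam is trivial, flag `trivial_seam`). -/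
theorem D1_assembly : StripFixedPoint → StripGluing → PolyhedralDssProfileExists := fun h g => g h

/-- **D1 collapses**: the crux gives the strip fixed point outright (restrict to one period through
a nontrivial slice; the matching condition is the DSS identity). So the ∃-piece of D1 is the crux
again up to the routine gluing lemma. -/
theorem crux_imp_stripFixedPoint : PolyhedralDssProfileExists → StripFixedPoint := by
  rintro ⟨G, hfin, hdet, hirr, c, hc, u, hanc, hmeas, hdss, hdec, heqv, hnt⟩
  obtain ⟨t₀, ht₀, hne⟩ : ∃ t, t < 0 ∧ ¬ (u t =ᵐ[volume] 0) := by
    by_contra h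
    exact hnt fun t ht => Classical.by_contradiction fun hne => h ⟨t, ht, hne⟩
  have hc0 : 0 < c := lt_trans zero_lt_one hc
  have hc2 : 0 < c ^ 2 := by positivity
  have hstrip : t₀ / c ^ 2 < 0 := div_neg_of_neg_of_pos ht₀ hc2
  obtain ⟨C₀, hC₀⟩ := hdec
  refine ⟨G, hfin, hdet, hirr, c, hc, t₀, ht₀, u, ?_, ?_, ?_, ⟨C₀, ?_⟩, ?_, ?_, hne⟩
  · intro t ht
    exact hanc.1 t (lt_of_le_of_lt ht.2 hstrip)
  · intro s t _ hst ht
    exact hanc.2 s t hst (lt_of_le_of_lt ht hstrip)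
  · intro t ht
    exact hmeas t (lt_of_le_of_lt ht.2 hstrip)
  · intro t ht x
    exact hC₀ t (lt_of_le_of_lt ht.2 hstrip) x
  · intro g hg t _ x
    exact heqv g hg t x
  · intro x
    have h := congrFun (congrFun (show nsRescale c u = u from hdss) (t₀ / c ^ 2)) x
    rw [nsRescale_apply] at h
    have hct : c ^ 2 * (t₀ / c ^ 2) = t₀ := by field_simp
    rw [hct] at h
    exact h.symm

/-- **D2 · the scheme piece of a certificate split** (abstract Banach-ball fixed point =
Newton–Kantorovich after preconditioning; radii-polynomial form). KNOWN mathematics, typed here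
only to show what the crux-independent half of a computer-assisted split looks like; the
crux-side half ("the polyhedral DSS profile problem is conjugate to `T x = x` on a ball of a
Banach space `Y` around an explicit candidate `x̄` with contraction constant `Z < 1` and defect
`‖T x̄ − x̄‖ ≤ (1 − Z) r`") has no candidate `x̄` and no model `Y` in which the linearisation is
Fredholm (census §4). -/
def BanachBallFixedPointScheme : Prop :=
  ∀ (Y : Type) [NormedAddCommGroup Y] [NormedSpace ℝ Y] [CompleteSpace Y]
    (T : Y → Y) (xbar : Y) (r Z : ℝ), 0 < r → 0 ≤ Z → Z < 1 →
    (∀ x ∈ Metric.closedBall xbar r, ∀ y ∈ Metric.closedBall xbar r, ‖T x - T y‖ ≤ Z * ‖x - y‖) →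
    ‖T xbar - xbar‖ ≤ (1 - Z) * r →
    ∃ x ∈ Metric.closedBall xbar r, T x = x

/-- Zero final trace at `t = 0⁻` in `L²_loc(ℝ³ ∖ {0})` (an a.e.-robust trace notion). -/
def HasZeroFinalTrace (u : ℝ → E3 → E3) : Prop :=
  ∀ K : Set E3, IsCompact K → (0 : E3) ∉ K →
    Tendsto (fun t => ∫ x in K, ‖u t x‖ ^ 2) (𝓝[<] (0 : ℝ)) (𝓝 0)

/-- **D3 · piece A (`NonzeroTraceProfileExists`).** The crux with its nontriviality clause
replaced by "the scale-invariant final trace at `t = 0⁻` is not zero in `L²_loc(ℝ³ ∖ {0})`"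
(the 'final-value' reading: backward DSS Type-I profiles are parametrised by their discretely
(−1)-homogeneous final traces, the free far-field / neutral Floquet data). -/
def NonzeroTraceProfileExists : Prop :=
  ∃ G : Subgroup (E3 ≃ₗᵢ[ℝ] E3), Finite G ∧
    (∀ g ∈ G, LinearMap.det (g.toLinearEquiv : E3 →ₗ[ℝ] E3) = 1) ∧
    (∀ V : Submodule ℝ E3, (∀ g ∈ G, ∀ v ∈ V, g v ∈ V) → V = ⊥ ∨ V = ⊤) ∧
  ∃ c : ℝ, 1 < c ∧ ∃ u : ℝ → E3 → E3, IsAncientMildSolution 1 u ∧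
    (∀ t < 0, AEStronglyMeasurable (u t) volume) ∧ IsDiscretelySelfSimilar c u ∧
    (∃ C₀ : ℝ, HasTypeIDecay C₀ u) ∧ (∀ g ∈ G, ∀ t x, u t (g x) = g (u t x)) ∧
    ¬ HasZeroFinalTrace u

/-- **D3 · piece B (`TrivialTraceLiouville`).** A Type-I `c`-DSS ancient mild solution with ZERO
final trace vanishes. The KNOWN half: backward uniqueness across `t = 0` in the exterior of a
ball plus spatial unique continuation (Escauriaza–Seregin–Šverák 2003), after interior
regularity of locally bounded mild solutions. -/
def TrivialTraceLiouville : Prop :=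
  ∀ c : ℝ, 1 < c → ∀ u : ℝ → E3 → E3, IsAncientMildSolution 1 u →
    (∀ t < 0, AEStronglyMeasurable (u t) volume) → IsDiscretelySelfSimilar c u →
    (∃ C₀ : ℝ, HasTypeIDecay C₀ u) → HasZeroFinalTrace u → ∀ t < 0, u t =ᵐ[volume] 0

/-- Piece A gives the crux ON ITS OWN (a slice-wise a.e.-zero field has zero `L²_loc` trace) —
BC2(c) fails: D3 is a restatement of the crux, not a redirect. -/
theorem nonzeroTrace_imp_crux : NonzeroTraceProfileExists → PolyhedralDssProfileExists := by
  rintro ⟨G, hfin, hdet, hirr, c, hc, u, hanc, hmeas, hdss, hdec, heqv, htr⟩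
  refine ⟨G, hfin, hdet, hirr, c, hc, u, hanc, hmeas, hdss, hdec, heqv, fun hzero => htr ?_⟩
  intro K _hK _h0
  have hval : ∀ t < (0 : ℝ), (∫ x in K, ‖u t x‖ ^ 2) = 0 := by
    intro t ht
    refine integral_eq_zero_of_ae ?_
    filter_upwards [ae_restrict_of_ae (hzero t ht)] with x hx
    simp [hx]
  refine (tendsto_congr' ?_).mpr tendsto_const_nhds
  exact eventually_nhdsWithin_of_forall fun t ht => hval t ht

/-- With the ESŠ-type piece B the crux and piece A are EQUIVALENT: the final-value reformulation
re-types the nontriviality clause and moves no difficulty. -/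
theorem crux_iff_nonzeroTrace (hB : TrivialTraceLiouville) :
    PolyhedralDssProfileExists ↔ NonzeroTraceProfileExists := by
  refine ⟨?_, nonzeroTrace_imp_crux⟩
  rintro ⟨G, hfin, hdet, hirr, c, hc, u, hanc, hmeas, hdss, hdec, heqv, hnt⟩
  exact ⟨G, hfin, hdet, hirr, c, hc, u, hanc, hmeas, hdss, hdec, heqv,
    fun hz => hnt (hB c hc u hanc hmeas hdss hdec hz)⟩

/-! ## §3 Typed strengthening -/

/-- **S⁺₁ (`SteadyPolyhedralProfileExists`).** The crux with discrete self-similarity upgraded to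
continuous self-similarity (`IsSelfSimilar`: a steady profile in similarity variables, a relative
equilibrium instead of a periodic orbit). Strictly stronger (`steady_imp_crux`) — and EMPTY:
a Type-I self-similar ancient mild solution is Leray's backward self-similar solution with a
bounded profile decaying like `|y|⁻¹`, hence in `L^q`, `3 < q < ∞`, hence zero by Tsai 1998 Thm 1
(`Literature.Analysis.FluidPDE.tsai_selfsimilar`, proved in tree `tsai_selfsimilar_holds`) /
NRŠ 1996. The added rigidity kills the object instead of exposing it (census §3). -/
def SteadyPolyhedralProfileExists : Prop :=
  ∃ G : Subgroup (E3 ≃ₗᵢ[ℝ] E3), Finite G ∧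
    (∀ g ∈ G, LinearMap.det (g.toLinearEquiv : E3 →ₗ[ℝ] E3) = 1) ∧
    (∀ V : Submodule ℝ E3, (∀ g ∈ G, ∀ v ∈ V, g v ∈ V) → V = ⊥ ∨ V = ⊤) ∧
  ∃ u : ℝ → E3 → E3, IsAncientMildSolution 1 u ∧
    (∀ t < 0, AEStronglyMeasurable (u t) volume) ∧ IsSelfSimilar u ∧
    (∃ C₀ : ℝ, HasTypeIDecay C₀ u) ∧ (∀ g ∈ G, ∀ t x, u t (g x) = g (u t x)) ∧
    ¬ (∀ t < 0, u t =ᵐ[volume] 0)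

/-- `S⁺₁ → C` (a self-similar field is `2`-DSS). -/
theorem steady_imp_crux : SteadyPolyhedralProfileExists → PolyhedralDssProfileExists := by
  rintro ⟨G, hfin, hdet, hirr, u, hanc, hmeas, hss, hdec, heqv, hnt⟩
  exact ⟨G, hfin, hdet, hirr, 2, by norm_num, u, hanc, hmeas,
    hss.isDiscretelySelfSimilar (by norm_num), hdec, heqv, hnt⟩

end Summit.NavierStokesRegularity.NavierStokesRegularity.Cruxes.PolyhedralDssProfileExists.S14g10
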